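import Literature.Geometry.Kaehler.ComplexTorusAnalyticProperIteratedIntersectionCycle
import Literature.Geometry.Kaehler.ComplexTorusAnalyticBezoutInequality
import Literature.Geometry.Kaehler.ComplexTorusChainProjectionPullback
import HarnessLib

/-!
# Bézout's theorem for proper iterated intersections on a polarised complex torus: the number of
# components is at most the intersection number, and `#⋂_j (D_j − t_j) ≤ (D₀ · … · D_{g−1})` for EVERY proper
# choice of translates

Layer `Literature/Geometry/Kaehler`; lane `lit-hodgefound`, seat p07, programme «INTERSECTION NUMBERS ARE
POINT COUNTS», file 9. Let `X = E/Λ` be a compact complex torus of dimension `g`, `Y ⊆ X` closed analytic of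
pure dimension `d = r + k`, `D₀, …, D_{k−1} ⊆ X` closed analytic hypersurfaces, `τ ∈ X^k`, and suppose that
`Z(τ) = Y ∩ ⋂_j (D_j − τ_j)` is PROPER (empty or of pure dimension `r`). By file 8
(`ComplexTorusAnalyticProperIteratedIntersectionCycle`) the intersection class is
`sign(e)^k · [Y]_e ∧ [D₀]_e ∧ ⋯ ∧ [D_{k−1}]_e = [Z(τ)]_e + cl(T) = Σ_C i(C) [C]`, `T ≥ 0` on `Z(τ)`, `i(C) ≥ 1`.
Pairing with a form which is non-negative on subvarieties — the flat Kähler power `ω^r/r!`, or the power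
`c₁(L)^{∧r}` of a polarisation `L` (`η` a Riemann form, `c₁(L) = ofRealForm(−η)`) — gives Bézout's theorem
in Fulton's form:

> [Fulton1998, §8.4 Example 8.4.6, p. 148]: "the number of irreducible components of `V₁ ∩ … ∩ V_r` is at
> most `Π deg(V_i)`" (indeed `Σ_i deg Z_i ≤ Π_j deg V_j` over the components `Z_i`); Prop. 8.4 (Bézout's
> theorem): `Σ i(Z_j; V₁·…·V_r) deg(Z_j) = Π deg(V_i)` for a proper intersection; Example 12.2.1 (a) for
> abelian varieties. [deJong1993AmpleLineBundles, Ch. VII §4 Remarks 4.3 (a), (c), (e) and Thm. 4.3.1]: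
> `deg_L C = (L^r · C)` is a positive integer for every closed subvariety `C` of dimension `r`.

Contents (theorems only; no definitions, no named facts):

* §1 `re_poincarePairing_setCycleClass_le_of_proper_of_forall_nonneg` — for every `2r`-form `θ` pairing
  non-negatively with the `r`-dimensional subvarieties, `Re ⟨θ, [Z(τ)]⟩ ≤ Re ⟨θ, sign(e)^k · [Y] ∧ [D₀] ∧ ⋯⟩`
  (the excess `T` is effective); the polarised case `IsRiemannForm.re_poincarePairing_wedgePow_setCycleClass_le_of_proper`;
* §2 **`IsRiemannForm.ncard_isIrreducibleComponent_le_re_poincarePairing_of_proper`** — BÉZOUT: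
  `#{irreducible components of Z(τ)} ≤ (L^r · Y · D₀ ⋯ D_{k−1}) := Re ⟨c₁(L)^{∧r}, sign(e)^k · [Y]_e ∧ [D₀]_e ∧ ⋯⟩`
  for EVERY proper `τ` (each component `C` contributes `i(C) · deg_L C ≥ 1`); `…_le_of_poincarePairing_eq_natCast`;
* §3 expected dimension ZERO, hypersurfaces only (`e` positively oriented, `g = dim X` hypersurfaces):
  **`exists_nat_torusIntegral_wedgeFamily_eq_ncard_add`** — if `⋂_{j<g} (D_j − τ_j)` is FINITE and non-empty
  then `(D₀ · … · D_{g−1}) = ∫_X [D₀]_e ∧ ⋯ ∧ [D_{g−1}]_e = #⋂_j (D_j − τ_j) + m` with `m ∈ ℕ` (the total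
  excess multiplicity), so **`#⋂_j (D_j − τ_j) ≤ (D₀ · … · D_{g−1})`**
  (`ncard_iInter_translate_le_re_torusIntegral_wedgeFamily`) — for EVERY proper `τ`, complementing the
  almost-everywhere EQUALITY of `ComplexTorusAnalyticHypersurfaceTranslatesPointCount`; and for one
  non-degenerate hypersurface `D` (`(D^g) ≠ 0`, so `[D] = c₁(L)`, `L` of type `(d₁, …, d_g)`):
  **`exists_isPolarizationType_forall_ncard_iInter_translate_le_factorial_mul`** — EVERY `g` translates of `D`
  meeting in finitely many points meet in AT MOST `g! · d₁⋯d_g` points (Riemann–Roch `(D^g) = g!·d₁⋯d_g`,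
  [Lange2023AbelianVarietiesComplex, §3.6, §4.6.2 p. 235]).

## References

* [Fulton1998] W. Fulton, *Intersection Theory*, 2nd ed., Springer 1998, §7.1 Prop. 7.1 (a), §8.2 (8.8),
  §8.4 Prop. 8.4 and Examples 8.4.6–8.4.7, §12.2 Example 12.2.1 (a).
* [deJong1993AmpleLineBundles] J. de Jong (ed.), *Ample line bundles and intersection theory* (seminar
  notes), Ch. VII §4 Remarks 4.3 (a), (c), (e) and Thm. 4.3.1.
* [Lange2023AbelianVarietiesComplex] H. Lange, *Abelian Varieties over the Complex Numbers*, Springer 2023,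
  §1.7.2 Thm. 1.7.3, §3.6, §4.6.2 (Lemma 4.6.4, p. 235).
* [VoisinHodgeI2002] C. Voisin, *Hodge Theory and Complex Algebraic Geometry I*, CUP 2002, §11.1.2, §12.1.3.
-/

noncomputable section

open scoped Manifold Topology Pointwise
open MeasureTheory Set Function Filter Module
open Literature.LinearAlgebra.Alternating

namespace Literature.Geometry.Kaehler
namespace ComplexTorus

universe u

variable {ι : Type*} [Fintype ι] [DecidableEq ι] {E : Type u} [NormedAddCommGroup E] [InnerProductSpace ℂ E]
  [FiniteDimensional ℂ E] [MeasurableSpace E] [BorelSpace E] (Φ : (ι → ℝ) ≃L[ℝ] E) {n : ℕ} (e : Fin n ≃ ι)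

/-! ### §1 The intersection class dominates the class of the intersection against non-negative forms -/

/-- **`Re ⟨θ, cl(T)⟩ ≥ 0` for an effective cycle `T` and a form `θ` pairing non-negatively with the
`r`-dimensional subvarieties.** [cite: VoisinHodgeI2002, §11.1.2 Cor. 11.15 and Rem. 11.19] -/
theorem re_poincarePairing_chainCycleClass_nonneg_of_forall_nonneg {r k' : ℕ} (h : 2 * r + k' = n)
    (T : HolomorphicChain 𝓘(ℂ, E) (ComplexTorus Φ) r) (hT : ∀ W, 0 ≤ T.mult W) (θ : E [⋀^Fin (2 * r)]→L[ℝ] ℂ)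
    (hθ : ∀ (W : Set (ComplexTorus Φ)), HasPureDim 𝓘(ℂ, E) W r → 0 ≤ (poincarePairing Φ e h θ (setCycleClass Φ e h W)).re) :
    0 ≤ (poincarePairing Φ e h θ (chainCycleClass Φ e h T)).re := by
  rw [poincarePairing_chainCycleClass, Complex.re_sum]
  refine Finset.sum_nonneg fun W hW ↦ ?_
  have hW0 : T.mult W ≠ 0 := T.finite_components_of_compactSpace.mem_toFinset.1 hW
  rw [← Complex.ofReal_intCast, Complex.re_ofReal_mul]
  exact mul_nonneg (by exact_mod_cast hT W) (hθ W (T.hasPureDim_of_mult_ne_zero hW0))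

/-- **`Re ⟨θ, [Z(τ)]⟩ ≤ Re ⟨θ, sign(e)^k · [Y] ∧ [D₀] ∧ ⋯ ∧ [D_{k−1}]⟩`** for an arbitrary proper
`Z(τ) = Y ∩ ⋂_j (D_j − τ_j)` and every `2r`-form `θ` pairing non-negatively with the `r`-dimensional
subvarieties: the difference is `Re ⟨θ, cl(T)⟩ ≥ 0` for the effective excess cycle `T` of file 8.
[cite: Fulton1998, §7.1 Prop. 7.1 (a), §8.2 and §12.2 Example 12.2.1 (a)] [cite: VoisinHodgeI2002, §11.1.2 Rem. 11.19] -/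
theorem re_poincarePairing_setCycleClass_le_of_proper_of_forall_nonneg {q : ℕ} (hq : 2 * q + 2 * 1 = n)
    (k : ℕ) {d p p' r : ℕ} (hk : 2 * d + 2 * p = n) (hp' : p + k = p') (hr : r + k = d)
    {Y : Set (ComplexTorus Φ)} (hY : HasPureDim 𝓘(ℂ, E) Y d)
    {D : Fin k → Set (ComplexTorus Φ)} (hD : ∀ j, HasPureDim 𝓘(ℂ, E) (D j) q) (τ : Fin k → ComplexTorus Φ)
    (hZ : Y ∩ ⋂ j, (fun x ↦ x + τ j) ⁻¹' D j = ∅ ∨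
      HasPureDim 𝓘(ℂ, E) (Y ∩ ⋂ j, (fun x ↦ x + τ j) ⁻¹' D j) r)
    (θ : E [⋀^Fin (2 * r)]→L[ℝ] ℂ)
    (hθ : ∀ (W : Set (ComplexTorus Φ)), HasPureDim 𝓘(ℂ, E) W r →
      0 ≤ (poincarePairing Φ e (by omega : 2 * r + 2 * p' = n) θ
        (setCycleClass Φ e (by omega : 2 * r + 2 * p' = n) W)).re) :
    (poincarePairing Φ e (by omega : 2 * r + 2 * p' = n) θ
        (setCycleClass Φ e (by omega : 2 * r + 2 * p' = n) (Y ∩ ⋂ j, (fun x ↦ x + τ j) ⁻¹' D j))).re ≤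
      (poincarePairing Φ e (by omega : 2 * r + 2 * p' = n) θ
        ((orientationSign Φ e : ℂ) ^ k •
          ((analyticCycleClass Φ e hk hY).wedge
              (wedgeFamily k fun j ↦ analyticCycleClass Φ e hq (hD j))).domDomCongr
            (finCongr (by omega : 2 * p + 2 * k = 2 * p')))).re := by
  obtain ⟨T, hT0, -, hTcl⟩ :=
    exists_effectiveCycle_smul_wedge_wedgeFamily_eq_setCycleClass_add_of_proper Φ e hq k hk hp' hr hY hD τ hZ
  rw [hTcl, map_add, Complex.add_re]
  exact le_add_of_nonneg_right (re_poincarePairing_chainCycleClass_nonneg_of_forall_nonneg Φ e _ T hT0 θ hθ)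

/-- **Polarised form: `(L^r · Z(τ)) ≤ (L^r · Y · D₀ ⋯ D_{k−1})`** — with `θ = c₁(L)^{∧r}`, `c₁(L) = ofRealForm(−η)`
for a Riemann form `η` (`(L^r · W) > 0` on subvarieties, [deJong1993AmpleLineBundles, VII Thm. 4.3.1]).
[cite: Fulton1998, §8.4 Prop. 8.4 and §12.2 Example 12.2.1 (a)] [cite: deJong1993AmpleLineBundles, Ch. VII §4 Thm. 4.3.1] -/
theorem IsRiemannForm.re_poincarePairing_wedgePow_setCycleClass_le_of_proper {q : ℕ} (hq : 2 * q + 2 * 1 = n)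
    (k : ℕ) {d p p' r : ℕ} (hk : 2 * d + 2 * p = n) (hp' : p + k = p') (hr : r + k = d)
    {Y : Set (ComplexTorus Φ)} (hY : HasPureDim 𝓘(ℂ, E) Y d)
    {D : Fin k → Set (ComplexTorus Φ)} (hD : ∀ j, HasPureDim 𝓘(ℂ, E) (D j) q) (τ : Fin k → ComplexTorus Φ)
    (hZ : Y ∩ ⋂ j, (fun x ↦ x + τ j) ⁻¹' D j = ∅ ∨
      HasPureDim 𝓘(ℂ, E) (Y ∩ ⋂ j, (fun x ↦ x + τ j) ⁻¹' D j) r)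
    {η : E [⋀^Fin 2]→L[ℝ] ℝ} (hη : IsRiemannForm Φ η) :
    (poincarePairing Φ e (by omega : 2 * r + 2 * p' = n) (wedgePow (ofRealForm (-η)) r)
        (setCycleClass Φ e (by omega : 2 * r + 2 * p' = n) (Y ∩ ⋂ j, (fun x ↦ x + τ j) ⁻¹' D j))).re ≤
      (poincarePairing Φ e (by omega : 2 * r + 2 * p' = n) (wedgePow (ofRealForm (-η)) r)
        ((orientationSign Φ e : ℂ) ^ k •
          ((analyticCycleClass Φ e hk hY).wedge
              (wedgeFamily k fun j ↦ analyticCycleClass Φ e hq (hD j))).domDomCongr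
            (finCongr (by omega : 2 * p + 2 * k = 2 * p')))).re := by
  refine re_poincarePairing_setCycleClass_le_of_proper_of_forall_nonneg Φ e hq k hk hp' hr hY hD τ hZ _
    fun W hW ↦ ?_
  rw [setCycleClass_of_hasPureDim Φ e _ hW]
  exact (hη.re_poincarePairing_wedgePow_analyticCycleClass_pos Φ e _ hW).le

/-! ### §2 Bézout: the number of components of a proper iterated intersection is at most the intersection number -/

/-- **BÉZOUT'S THEOREM ON A POLARISED COMPLEX TORUS (arbitrary proper iterated intersections).** Let `η` be a
Riemann form (`L` the polarisation, `c₁(L) = ofRealForm(−η)`), `Y` closed analytic of pure dimension `r + k`,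
`D₀, …, D_{k−1}` closed analytic hypersurfaces and `τ ∈ X^k` with `Z(τ) = Y ∩ ⋂_j (D_j − τ_j)` proper. Then

  `#{irreducible components of Z(τ)} ≤ (L^r · Y · D₀ ⋯ D_{k−1}) = Re ⟨c₁(L)^{∧r}, sign(e)^k · [Y]_e ∧ [D₀]_e ∧ ⋯⟩`:

every component `C` contributes `i(C) · (L^r · C)` with `i(C) ≥ 1` (file 8) and `(L^r · C)` a positive integer.
[cite: Fulton1998, §8.4 Prop. 8.4 and Example 8.4.6 (p. 148); §12.2 Example 12.2.1 (a)]
[cite: deJong1993AmpleLineBundles, Ch. VII §4 Remarks 4.3 (a), (c) and Thm. 4.3.1] -/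
theorem IsRiemannForm.ncard_isIrreducibleComponent_le_re_poincarePairing_of_proper {q : ℕ}
    (hq : 2 * q + 2 * 1 = n) (k : ℕ) {d p p' r : ℕ} (hk : 2 * d + 2 * p = n) (hp' : p + k = p') (hr : r + k = d)
    {Y : Set (ComplexTorus Φ)} (hY : HasPureDim 𝓘(ℂ, E) Y d)
    {D : Fin k → Set (ComplexTorus Φ)} (hD : ∀ j, HasPureDim 𝓘(ℂ, E) (D j) q) (τ : Fin k → ComplexTorus Φ)
    (hZ : Y ∩ ⋂ j, (fun x ↦ x + τ j) ⁻¹' D j = ∅ ∨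
      HasPureDim 𝓘(ℂ, E) (Y ∩ ⋂ j, (fun x ↦ x + τ j) ⁻¹' D j) r)
    {η : E [⋀^Fin 2]→L[ℝ] ℝ} (hη : IsRiemannForm Φ η) :
    (({C : Set (ComplexTorus Φ) |
        IsIrreducibleComponent 𝓘(ℂ, E) (Y ∩ ⋂ j, (fun x ↦ x + τ j) ⁻¹' D j) C}.ncard : ℕ) : ℝ) ≤
      (poincarePairing Φ e (by omega : 2 * r + 2 * p' = n) (wedgePow (ofRealForm (-η)) r)
        ((orientationSign Φ e : ℂ) ^ k •
          ((analyticCycleClass Φ e hk hY).wedge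
              (wedgeFamily k fun j ↦ analyticCycleClass Φ e hq (hD j))).domDomCongr
            (finCongr (by omega : 2 * p + 2 * k = 2 * p')))).re := by
  have hle := hη.re_poincarePairing_wedgePow_setCycleClass_le_of_proper Φ e hq k hk hp' hr hY hD τ hZ
  rcases hZ with hZ0 | hZr
  · have hnone : {C : Set (ComplexTorus Φ) |
        IsIrreducibleComponent 𝓘(ℂ, E) (Y ∩ ⋂ j, (fun x ↦ x + τ j) ⁻¹' D j) C} = ∅ := by
      refine eq_empty_of_forall_notMem fun C hC ↦ ?_
      obtain ⟨z, hz⟩ := hC.isIrreducibleAnalyticSet.2.1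
      have := hC.subset hz
      rw [hZ0] at this
      exact this
    rw [hnone, Set.ncard_empty, Nat.cast_zero]
    have h0 : setCycleClass Φ e (by omega : 2 * r + 2 * p' = n) (Y ∩ ⋂ j, (fun x ↦ x + τ j) ⁻¹' D j) = 0 := by
      have hne : ¬ HasPureDim 𝓘(ℂ, E) (Y ∩ ⋂ j, (fun x ↦ x + τ j) ⁻¹' D j) r := fun h' ↦ by
        have := h'.nonempty
        rw [hZ0] at this
        exact Set.not_nonempty_empty this
      rw [setCycleClass, dif_neg hne]
    rw [h0, map_zero, Complex.zero_re] at hle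
    exact hle
  · refine le_trans ?_ hle
    rw [setCycleClass_of_hasPureDim Φ e _ hZr]
    exact hη.ncard_isIrreducibleComponent_le_re_poincarePairing_wedgePow_analyticCycleClass Φ e _ hZr

/-- **If `(L^r · Y · D₀ ⋯ D_{k−1}) = m ∈ ℕ`, every proper `Z(τ)` has at most `m` irreducible components.**
[cite: Fulton1998, §8.4 Example 8.4.6 and §12.2 Example 12.2.1 (a)] [cite: deJong1993AmpleLineBundles, Ch. VII §4 Thm. 4.3.1] -/
theorem IsRiemannForm.ncard_isIrreducibleComponent_le_of_proper_of_poincarePairing_eq_natCast {q : ℕ}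
    (hq : 2 * q + 2 * 1 = n) (k : ℕ) {d p p' r : ℕ} (hk : 2 * d + 2 * p = n) (hp' : p + k = p') (hr : r + k = d)
    {Y : Set (ComplexTorus Φ)} (hY : HasPureDim 𝓘(ℂ, E) Y d)
    {D : Fin k → Set (ComplexTorus Φ)} (hD : ∀ j, HasPureDim 𝓘(ℂ, E) (D j) q) (τ : Fin k → ComplexTorus Φ)
    (hZ : Y ∩ ⋂ j, (fun x ↦ x + τ j) ⁻¹' D j = ∅ ∨
      HasPureDim 𝓘(ℂ, E) (Y ∩ ⋂ j, (fun x ↦ x + τ j) ⁻¹' D j) r)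
    {η : E [⋀^Fin 2]→L[ℝ] ℝ} (hη : IsRiemannForm Φ η) {m : ℕ}
    (hm : poincarePairing Φ e (by omega : 2 * r + 2 * p' = n) (wedgePow (ofRealForm (-η)) r)
        ((orientationSign Φ e : ℂ) ^ k •
          ((analyticCycleClass Φ e hk hY).wedge
              (wedgeFamily k fun j ↦ analyticCycleClass Φ e hq (hD j))).domDomCongr
            (finCongr (by omega : 2 * p + 2 * k = 2 * p'))) = m) :
    {C : Set (ComplexTorus Φ) |
      IsIrreducibleComponent 𝓘(ℂ, E) (Y ∩ ⋂ j, (fun x ↦ x + τ j) ⁻¹' D j) C}.ncard ≤ m := by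
  have h := hη.ncard_isIrreducibleComponent_le_re_poincarePairing_of_proper Φ e hq k hk hp' hr hY hD τ hZ
  rw [hm, Complex.natCast_re] at h
  exact_mod_cast h

/-! ### §3 Expected dimension zero: `#⋂_j (D_j − t_j) ≤ (D₀ · … · D_{g−1})` for every proper choice of translates -/

section DimensionZero

variable {g : ℕ} (e : Fin (2 * g) ≃ ι)

omit [DecidableEq ι] [FiniteDimensional ℂ E] [MeasurableSpace E] [BorelSpace E] in
/-- A finite intersection of closed analytic subsets of the torus is analytic. [cite: Chirka1989, §2.1 item 3] -/
private theorem isAnalyticSet_iInter_fin {k : ℕ} {A : Fin k → Set (ComplexTorus Φ)}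
    (hA : ∀ j, IsAnalyticSet 𝓘(ℂ, E) (A j)) : IsAnalyticSet 𝓘(ℂ, E) (⋂ j, A j) := by
  classical
  have h : ∀ s : Finset (Fin k), IsAnalyticSet 𝓘(ℂ, E) (⋂ j ∈ s, A j) := by
    intro s
    induction s using Finset.induction_on with
    | empty => simpa using (isAnalyticSet_univ : IsAnalyticSet 𝓘(ℂ, E) (univ : Set (ComplexTorus Φ)))
    | insert j s hj ih =>
      rw [Finset.set_biInter_insert]
      exact (hA j).inter ih
  simpa using h Finset.univ

omit [DecidableEq ι] [MeasurableSpace E] [BorelSpace E] in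
/-- **A finite non-empty analytic subset has pure dimension `0`** (its points are isolated).
[cite: Chirka1989, §2.3, p. 23; §12.1, p. 136] -/
private theorem hasPureDim_zero_of_finite₉ {Z : Set (ComplexTorus Φ)} (hZ : IsAnalyticSet 𝓘(ℂ, E) Z)
    (hfin : Z.Finite) (hne : Z.Nonempty) : HasPureDim 𝓘(ℂ, E) Z 0 := by
  refine hasPureDim_zero_of_forall_isolated hZ hne fun a ha ↦ ?_
  refine ⟨(Z \ {a})ᶜ, (hfin.subset fun x hx ↦ hx.1).isClosed.isOpen_compl.mem_nhds (by simp), fun x hx ↦ ?_⟩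
  by_contra hxa
  exact hx.1 ⟨hx.2, hxa⟩

/-- **`(D₀ · … · D_{g−1}) = #⋂_j (D_j − τ_j) + m`, `m ∈ ℕ`, whenever the `g` translates meet in FINITELY MANY
points** (`g = dim X` closed analytic hypersurfaces `D_j`, `e` positively oriented): by file 8 (`Y = X`,
expected dimension `0`) `[D₀]_e ∧ ⋯ ∧ [D_{g−1}]_e = [Z(τ)]_e + cl(T)` with `T ≥ 0` a `0`-cycle on
`Z(τ) = ⋂_j (D_j − τ_j)`, and `∫_X [Z(τ)]_e = #Z(τ)`, `∫_X cl(T) = Σ mult ≥ 0` (`[pt]_e = vol_e`). The excess `m` is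
the total intersection multiplicity beyond one ([Fulton1998, (8.8)]: `∫ V · W = Σ_P i(P; V · W)`).
[cite: Fulton1998, §7.1 Prop. 7.1 (a) and §8.2 (8.8)] [cite: Lange2023AbelianVarietiesComplex, §4.6.2 p. 235]
[cite: VoisinHodgeI2002, §12.1.3] -/
theorem exists_nat_torusIntegral_wedgeFamily_eq_ncard_add {q : ℕ} (hq : 2 * q + 2 * 1 = 2 * g)
    (he : orientationSign Φ e = 1) {D : Fin g → Set (ComplexTorus Φ)} (hD : ∀ j, HasPureDim 𝓘(ℂ, E) (D j) q)
    (τ : Fin g → ComplexTorus Φ) (hfin : (⋂ j, (fun x ↦ x + τ j) ⁻¹' D j).Finite)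
    (hne : (⋂ j, (fun x ↦ x + τ j) ⁻¹' D j).Nonempty) :
    ∃ m : ℕ, torusIntegral Φ e (wedgeFamily g fun j ↦ analyticCycleClass Φ e hq (hD j)) =
      ((⋂ j, (fun x ↦ x + τ j) ⁻¹' D j).ncard : ℂ) + m := by
  classical
  have hng : finrank ℂ E * 2 = 2 * g := finrank_complex_mul_two Φ e
  have hg : finrank ℂ E = g := by omega
  set Z := ⋂ j, (fun x ↦ x + τ j) ⁻¹' D j with hZdef
  -- a finite non-empty analytic set has pure dimension `0`
  have hZan : IsAnalyticSet 𝓘(ℂ, E) Z :=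
    isAnalyticSet_iInter_fin Φ fun j ↦ (hasPureDim_preimage_add_right Φ (hD j) (τ j)).isAnalyticSet
  have hZ0 : HasPureDim 𝓘(ℂ, E) Z 0 := hasPureDim_zero_of_finite₉ Φ hZan hfin hne
  obtain ⟨T, hT0, -, hTcl⟩ := exists_effectiveCycle_wedgeFamily_eq_setCycleClass_add_of_proper Φ e hq he g
    (r := 0) (by omega) hD τ (Or.inr hZ0)
  have h2 : 2 * 0 + 2 * g = 2 * g := by omega
  -- the volume form read in degree `2g`
  have hvol : volumeForm Φ ((finCongr (by omega : 2 * g = 2 * g)).trans e) = volumeForm Φ e := by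
    rw [finCongr_refl, Equiv.refl_trans]
  -- `∫_X [Z] = #Z`
  have hZcl : torusIntegral Φ e (setCycleClass Φ e h2 Z) = (Z.ncard : ℂ) := by
    rw [setCycleClass_of_hasPureDim Φ e h2 hZ0, analyticCycleClass_eq_ncard_smul_of_hasPureDim_zero Φ e h2 hZ0,
      analyticCycleClass_singleton_eq_volumeForm Φ e h2 _ he, hvol, torusIntegral_smul, torusIntegral_volumeForm,
      mul_one]
  -- `∫_X cl(T) = Σ mult ≥ 0`
  set N : ℤ := ∑ W ∈ T.finite_components_of_compactSpace.toFinset, T.mult W with hN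
  have hN0 : 0 ≤ N := Finset.sum_nonneg fun W _ ↦ hT0 W
  have hTint : torusIntegral Φ e (chainCycleClass Φ e h2 T) = (N : ℂ) := by
    rw [chainCycleClass_eq_degree_smul_volumeForm Φ e h2 T, hvol, torusIntegral_smul, torusIntegral_volumeForm,
      mul_one, he, Int.cast_one, mul_one]
  refine ⟨N.toNat, ?_⟩
  have hcast : ((N.toNat : ℕ) : ℂ) = (N : ℂ) := by
    have := Int.toNat_of_nonneg hN0
    exact_mod_cast this
  rw [hTcl, torusIntegral_add, hZcl, hTint, hcast]

/-- **`#⋂_j (D_j − τ_j) ≤ (D₀ · … · D_{g−1})` for EVERY choice of translates meeting in finitely many points**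
(the intersection number bounds the number of intersection points; equality for almost every `τ`,
`ComplexTorusAnalyticHypersurfaceTranslatesPointCount`). [cite: Fulton1998, §8.2 (8.8) and §8.4 Example 8.4.6]
[cite: Lange2023AbelianVarietiesComplex, §4.6.2 p. 235] -/
theorem ncard_iInter_translate_le_re_torusIntegral_wedgeFamily {q : ℕ} (hq : 2 * q + 2 * 1 = 2 * g)
    (he : orientationSign Φ e = 1) {D : Fin g → Set (ComplexTorus Φ)} (hD : ∀ j, HasPureDim 𝓘(ℂ, E) (D j) q)
    (τ : Fin g → ComplexTorus Φ) (hfin : (⋂ j, (fun x ↦ x + τ j) ⁻¹' D j).Finite) :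
    (((⋂ j, (fun x ↦ x + τ j) ⁻¹' D j).ncard : ℕ) : ℝ) ≤
      (torusIntegral Φ e (wedgeFamily g fun j ↦ analyticCycleClass Φ e hq (hD j))).re := by
  rcases (⋂ j, (fun x ↦ x + τ j) ⁻¹' D j).eq_empty_or_nonempty with h0 | hne
  · -- empty intersection: the intersection number vanishes
    have hng : finrank ℂ E * 2 = 2 * g := finrank_complex_mul_two Φ e
    have hcl0 : wedgeFamily g (fun j ↦ analyticCycleClass Φ e hq (hD j)) = 0 := by
      have hk : 2 * finrank ℂ E + 2 * 0 = 2 * g := by omega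
      have h := wedge_wedgeFamily_eq_zero_of_inter_iInter_translate_eq_empty Φ e hq g hk (by omega)
        (hasPureDim_univ (I := 𝓘(ℂ, E)) (M := ComplexTorus Φ)) hD τ (by rw [univ_inter]; exact h0)
      rw [analyticCycleClass_univ, he, Int.cast_one, one_smul, constOfIsEmpty_wedge_eq_smul, one_smul] at h
      have h' := congrArg (fun ω ↦ ω.domDomCongr (finCongr (by omega : 2 * 0 + 2 * g = 2 * g))) h
      simpa only [domDomCongr_finCongr_trans, domDomCongr_finCongr_self, domDomCongr_finCongr_zero]
        using h'
    rw [h0, Set.ncard_empty, Nat.cast_zero, hcl0, torusIntegral_zero, Complex.zero_re]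
  · obtain ⟨m, hm⟩ := exists_nat_torusIntegral_wedgeFamily_eq_ncard_add Φ e hq he hD τ hfin hne
    rw [hm, Complex.add_re, Complex.natCast_re, Complex.natCast_re]
    exact le_add_of_nonneg_right (Nat.cast_nonneg m)

/-- **EVERY `g` translates of a non-degenerate hypersurface meeting in finitely many points meet in AT MOST
`g! · d₁⋯d_g` points.** If `(D^g) ≠ 0` (`e` positively oriented) then `[D]_e = c₁(L)` for a polarisation `L`
of some type `(d₁, …, d_g)`, `(D^g) = g! · d₁⋯d_g` (Riemann–Roch), and `#⋂_j (D − τ_j) ≤ (D^g)` for every `τ`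
with finite intersection (the previous theorem). For almost every `τ` equality holds
(`exists_isPolarizationType_ae_ncard_iInter_translate_eq_factorial_mul`); e.g. `g` translates of a theta
divisor of a principally polarised abelian variety meeting properly meet in at most `g!` points.
[cite: Lange2023AbelianVarietiesComplex, §3.6, §1.7.2 Thm. 1.7.3 and §4.6.2 Lemma 4.6.4, p. 235]
[cite: Fulton1998, §8.2 (8.8) and §8.4 Example 8.4.6] -/
theorem exists_isPolarizationType_forall_ncard_iInter_translate_le_factorial_mul {q : ℕ}
    (hq : 2 * q + 2 * 1 = 2 * g) {D : Set (ComplexTorus Φ)} (hD : HasPureDim 𝓘(ℂ, E) D q)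
    (he : orientationSign Φ e = 1) (hDg : torusIntegral Φ e (wedgePow (analyticCycleClass Φ e hq hD) g) ≠ 0) :
    ∃ (η : E [⋀^Fin 2]→L[ℝ] ℝ) (d : Fin g → ℕ), IsRiemannForm Φ η ∧ IsPolarizationType Φ η d ∧
      analyticCycleClass Φ e hq hD = ofRealForm (-η) ∧
      ∀ τ : Fin g → ComplexTorus Φ, (⋂ j, (fun x ↦ x + τ j) ⁻¹' D).Finite →
        (⋂ j, (fun x ↦ x + τ j) ⁻¹' D).ncard ≤ g.factorial * ∏ i, d i := by
  obtain ⟨η, d, hη, hd, hcl, hnum⟩ :=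
    exists_isPolarizationType_torusIntegral_wedgePow_analyticCycleClass_eq Φ e hq hD he hDg
  refine ⟨η, d, hη, hd, hcl, fun τ hfin ↦ ?_⟩
  have h := ncard_iInter_translate_le_re_torusIntegral_wedgeFamily Φ e hq he (D := fun _ ↦ D) (fun _ ↦ hD) τ hfin
  have hw : wedgeFamily g (fun _ : Fin g ↦ analyticCycleClass Φ e hq hD) = wedgePow (analyticCycleClass Φ e hq hD) g :=
    rfl
  rw [hw, hnum] at h
  have hc : (g.factorial : ℂ) * ∏ i, (d i : ℂ) = ((g.factorial * ∏ i, d i : ℕ) : ℂ) := by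
    rw [Nat.cast_mul, Nat.cast_prod]
  rw [hc, Complex.natCast_re] at h
  exact_mod_cast h

end DimensionZero

end ComplexTorus

end Literature.Geometry.Kaehler

end
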